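import Summits.CriticalPhenomena.PercolationContinuityZ3.Theorems.FK.RadiusDecayRate
import Summits.CriticalPhenomena.PercolationContinuityZ3.Theorems.FK.BoxLimitComparison
import Summits.CriticalPhenomena.PercolationContinuityZ3.Theorems.FK.InfiniteVolumeQOne
import Literature.Probability.Percolation.SharpnessDCTProofs
import Literature.Probability.Percolation.LocalLimitConnections
import HarnessLib

/-!
# FK-continuity cell, FO-10a: the inverse correlation length of `φ^b_{p,q}` is POSITIVE throughout the Bernoulli
# subcritical regime `p < p_c(1) = p_c(ℤ^d)` — Grimmett 2006, Thm. (5.55) (the `ψ` clause), from the comparison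
# `φ^b_{p,q} ≤_st P_p` and the sharpness of the Bernoulli phase transition (the tree's Duminil-Copin–Tassion theorem)

Registered R119 (cell INBOX l.7674, 2026-08-25); registry row FO-10a-g343c; label COR-C (coordinator fk-4 g231).
Cell `fk-continuity` (bschramm), row FO-10a; support file for the FK-continuity transplant
(`--supports stmt-CriticalPhenomena-4575`); builds on p205010 (kernel theorem, internal audit signed; external expert
review pending). Third file of the correlation-length package (`ConnectivityDecayRate.lean`: the rate `ψ` exists along
every direction; `RadiusDecayRate.lean`: the radius law has the same rate). Pure proofs; no definitions, no named
facts, no sorries. UNCONDITIONAL (the sharpness input `perc_sharpness` is a THEOREM of the tree,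
`perc_sharpness_holds`, `SharpnessDCTProofs.lean`); decides nothing about `ψ(p,q) > 0` on the whole subcritical regime
`p < p_c(q)` of the random-cluster model (Grimmett's Conjecture (5.54): proved for `q ≥ 1` by Duminil-Copin–Raoufi–Tassion
2019 (Ann. Math. 189), not typed here; this file covers only `p < p_c(1)`), nor about FH / TP_FK / uniqueness.

Grimmett 2006, Thm. (5.55): "Let `q ∈ [1, ∞)` and `0 < p < p_c(1)`. Then `ψ(p,q) > 0` and `ζ(p,q) > 0`." Printed
proof: by Prop. (4.28)(a), `φ⁰_{p,q} ≤_st φ_p`, so `φ⁰_{p,q}(0 ↔ ∂Λ_n) ≤ φ_p(0 ↔ ∂Λ_n)`, whence `ψ(p,q) ≥ ψ(p,1)`,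
"and the strict positivity of `ψ` follows by the corresponding statement for percolation". Here: the comparison is the
tree's `IsBoxLimit.real_anti_right` at `q' = 1` with `φ^b_{p,1} = P_p` (`isBoxLimit_bondPercolation`), applied to the
increasing local event `{0 ↔ ∂Λ_n}`; the percolation statement is the tree's `perc_sharpness_holds`
(`P_p(0 ↔ ∂Λ_n) ≤ e^{-cn}`, `c = c(p) > 0`, for `p < p_c(ℤ^d)`, `d ≥ 2` — Duminil-Copin–Tassion 2016); positivity of
the rate then follows from the limits of `RadiusDecayRate.lean` / `ConnectivityDecayRate.lean`. We type the `ψ`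
clause for BOTH boundary conditions; the cluster-size clause `ζ(p,q) > 0` needs the exponential decay of `P_p(|C| ≥ n)`
and is not typed.

## Contents (namespace `Summit.CriticalPhenomena.PercolationContinuityZ3.Theorems.FK`)

* §1 Bernoulli domination of increasing local events: `IsBoxLimit.real_le_bondPercolation_real`
  (`φ^b_{p,q}(A) ≤ P_p(A)`, Prop. (4.28)(a) / (3.22) at `q' = 1`), `IsBoxLimit.real_siteToBoundary_le_bondPercolation`;
* §2 transfer of sharpness: **`IsBoxLimit.exists_real_siteToBoundary_le_exp_of_lt_criticalProb`**
  (`∃ c > 0, φ^b_{p,q}(0 ↔ ∂Λ_n) ≤ e^{-cn}` for all `n`, `p < p_c(ℤ^d)`, `d ≥ 2`) and the two-point form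
  `IsBoxLimit.exists_real_openConn_le_exp_of_lt_criticalProb` (`φ^b_{p,q}(0 ↔ x) ≤ e^{-cn}` for `x ∉ Λ_n`);
* §3 **Thm. (5.55), `ψ` clause**: `IsBoxLimit.exists_radiusDecayRate_pos_of_lt_criticalProb` (the common rate `ψ` of
  the axis two-point function and of the radius law is `> 0`), `IsBoxLimit.exists_decayRate_pos_of_lt_criticalProb`
  (along EVERY direction `u ≠ 0` the rate of `ConnectivityDecayRate.lean` is `> 0`), and the `rcLimit` forms
  `exists_radiusDecayRate_pos_rcLimit_of_lt_criticalProb` / `exists_decayRate_pos_rcLimit_of_lt_criticalProb`.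

## References

* G. Grimmett, *The Random-Cluster Model*, Springer 2006, §5.4: Thm. (5.55) with its proof (p. 112), Conjecture
  (5.54); Prop. (4.28)(a) / Thm. (3.21) (3.22) (comparison with percolation). [Grimmett2006]
* H. Duminil-Copin, V. Tassion, *A new proof of the sharpness of the phase transition for Bernoulli percolation on
  `ℤ^d`*, Enseign. Math. 62 (2016) 199–206, Thm. 1.1 (the tree's `perc_sharpness_holds`). [DuminilCopinTassionEM2016]
* G. Grimmett, *Percolation*, 2nd ed., Springer 1999, Thms. (5.4)/(6.1) (exponential decay below `p_c`).
  [GrimmettPercolation1999]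
-/

noncomputable section

open MeasureTheory Set Filter
open scoped Topology

namespace Summit.CriticalPhenomena.PercolationContinuityZ3.Theorems.FK

open Literature.Probability.Percolation Literature.Probability.LatticeModels
open Literature.Probability.Percolation.DCT16 (perc_sharpness_holds isUpperSet_siteToBoundary)

variable {d : ℕ} {b : Bool} {p q : ℝ} {P : Measure (BondConfig (Site d))}

/-! ### §1 Domination by Bernoulli percolation on increasing local events (Prop. (4.28)(a) at `q' = 1`) -/

/-- **`φ^b_{p,q}(A) ≤ P_p(A)` for every increasing local event `A`** (`0 ≤ p ≤ 1`, `q ≥ 1`): the comparison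
inequality (3.22) / Prop. (4.28)(a) in `q` between `q` and `q' = 1`, with `φ^b_{p,1} = P_p` (the tree's
`isBoxLimit_bondPercolation`). [cite: Grimmett2006, Prop. (4.28)(a); Thm. (3.21) eq. (3.22)] -/
theorem IsBoxLimit.real_le_bondPercolation_real (hP : IsBoxLimit d b p q P) (hp : p ∈ Set.Icc (0 : ℝ) 1)
    (hq : 1 ≤ q) {A : Set (BondConfig (Site d))} {K : Finset (Sym2 (Site d))} (hA : IsUpperSet A)
    (hAK : DeterminedBy A ↑K) : P.real A ≤ (bondPercolation (zdGraph d) ⟨p, hp⟩).real A :=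
  hP.real_anti_right (isBoxLimit_bondPercolation b ⟨p, hp⟩) hp le_rfl hq hA hAK

/-- `φ^b_{p,q}(0 ↔ ∂Λ_n) ≤ P_p(0 ↔ ∂Λ_n)` (`0 ≤ p ≤ 1`, `q ≥ 1`): the first display of the proof of Thm. (5.55).
[cite: Grimmett2006, Thm. (5.55) (proof)] -/
theorem IsBoxLimit.real_siteToBoundary_le_bondPercolation (hP : IsBoxLimit d b p q P) (hp : p ∈ Set.Icc (0 : ℝ) 1)
    (hq : 1 ≤ q) (n : ℕ) :
    P.real (siteToBoundary d n) ≤ (bondPercolation (zdGraph d) ⟨p, hp⟩).real (siteToBoundary d n) := by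
  obtain ⟨K, hK⟩ := isLocalEvent_siteToBoundary d n
  exact hP.real_le_bondPercolation_real hp hq (isUpperSet_siteToBoundary d n) hK

/-! ### §2 Sharpness of Bernoulli percolation transferred to `φ^b_{p,q}` for `p < p_c(ℤ^d)` -/

/-- **Exponential decay of the radius law of `φ^b_{p,q}` below `p_c(1)`**: for `d ≥ 2`, `0 ≤ p < p_c(ℤ^d)`,
`q ≥ 1` and either boundary condition there is `c > 0` with `φ^b_{p,q}(0 ↔ ∂Λ_n) ≤ e^{-cn}` for all `n`
(domination by `P_p` + the Duminil-Copin–Tassion sharpness theorem of the tree, `perc_sharpness_holds`).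
[cite: Grimmett2006, Thm. (5.55) (proof)] [cite: DuminilCopinTassionEM2016, Thm. 1.1 (1)] -/
theorem IsBoxLimit.exists_real_siteToBoundary_le_exp_of_lt_criticalProb (hd : 2 ≤ d) (hP : IsBoxLimit d b p q P)
    (hp : p ∈ Set.Icc (0 : ℝ) 1) (hq : 1 ≤ q) (hpc : p < criticalProb (zdGraph d) 0) :
    ∃ c : ℝ, 0 < c ∧ ∀ n : ℕ, P.real (siteToBoundary d n) ≤ Real.exp (-c * n) := by
  obtain ⟨c, hc, hcn⟩ := perc_sharpness_holds hd ⟨p, hp⟩ hpc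
  exact ⟨c, hc, fun n => (hP.real_siteToBoundary_le_bondPercolation hp hq n).trans (hcn n)⟩

/-- **Exponential decay of the two-point function of `φ^b_{p,q}` below `p_c(1)`**: with `c` as above,
`φ^b_{p,q}(0 ↔ x) ≤ e^{-cn}` for every `x ∉ Λ_n` (first exit from the box). [cite: Grimmett2006, Thm. (5.55) (proof)] -/
theorem IsBoxLimit.exists_real_openConn_le_exp_of_lt_criticalProb (hd : 2 ≤ d) (hP : IsBoxLimit d b p q P)
    (hp : p ∈ Set.Icc (0 : ℝ) 1) (hq : 1 ≤ q) (hpc : p < criticalProb (zdGraph d) 0) :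
    ∃ c : ℝ, 0 < c ∧ ∀ (n : ℕ) (x : Site d), x ∉ box d n → P.real (openConn (0 : Site d) x) ≤ Real.exp (-c * n) := by
  haveI := hP.isProbabilityMeasure
  obtain ⟨c, hc, hcn⟩ := hP.exists_real_siteToBoundary_le_exp_of_lt_criticalProb hd hp hq hpc
  exact ⟨c, hc, fun n x hx =>
    (real_openConn_le_real_siteToBoundary_of_notMem (hP.ae_subset_edgeSet hp (one_pos.trans_le hq)) hx).trans
      (hcn n)⟩

/-! ### §3 Grimmett 2006, Thm. (5.55): `ψ^b(p,q) > 0` for `0 < p < p_c(1)` -/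

/-- **Grimmett 2006, Thm. (5.55), `ψ` clause, radius form** (`d ≥ 2`, `0 < p < p_c(ℤ^d)`, `q ≥ 1`, free or wired,
reference axis `e_k`): the common exponential rate `ψ` of the axis two-point function and of the radius law of
`φ^b_{p,q}` (Thm. (5.44) / Cor. (5.45), `RadiusDecayRate.lean`) is STRICTLY POSITIVE — indeed `ψ ≥ c(p)`, the
Duminil-Copin–Tassion decay constant of `P_p`. [cite: Grimmett2006, Thm. (5.55)] -/
theorem IsBoxLimit.exists_radiusDecayRate_pos_of_lt_criticalProb (hd : 2 ≤ d) (hP : IsBoxLimit d b p q P)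
    (hp : p ∈ Set.Ioc (0 : ℝ) 1) (hq : 1 ≤ q) (hpc : p < criticalProb (zdGraph d) 0) (k : Fin d) :
    ∃ ψ : ℝ, 0 < ψ ∧
      Tendsto (fun n : ℕ => -Real.log (P.real (openConn (0 : Site d) (n • (Pi.single k (1 : ℤ) : Site d)))) / n)
        atTop (𝓝 ψ) ∧
      Tendsto (fun n : ℕ => -Real.log (P.real (siteToBoundary d n)) / n) atTop (𝓝 ψ) ∧
      (∀ n : ℕ, P.real (openConn (0 : Site d) (n • (Pi.single k (1 : ℤ) : Site d))) ≤ Real.exp (-(n * ψ))) ∧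
      ∀ n : ℕ, P.real (siteToBoundary d n) ≤ 2 * d * (2 * n + 1) ^ (d - 1) * Real.exp (-(n * ψ)) := by
  haveI := hP.isProbabilityMeasure
  have hp' : p ∈ Set.Icc (0 : ℝ) 1 := ⟨hp.1.le, hp.2⟩
  obtain ⟨ψ, -, hlimA, hlimR, hbdA, hbdR⟩ := hP.exists_radiusDecayRate hp hq k
  obtain ⟨c, hc, hcn⟩ := hP.exists_real_siteToBoundary_le_exp_of_lt_criticalProb hd hp' hq hpc
  refine ⟨ψ, ?_, hlimA, hlimR, hbdA, hbdR⟩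
  -- positivity of the radius law (first exit + finite energy) and `c ≤ -n⁻¹ log φ(0 ↔ ∂Λ_n)` for `n ≥ 1`
  have hβpos : ∀ n : ℕ, 0 < P.real (siteToBoundary d n) := fun n =>
    (hP.real_openConn_pos hp hq 0 _).trans_le
      (real_openConn_le_real_siteToBoundary_of_notMem (hP.ae_subset_edgeSet hp' (one_pos.trans_le hq))
        (succ_nsmul_single_one_notMem_box k n))
  refine hc.trans_le (ge_of_tendsto hlimR ?_)
  filter_upwards [eventually_ge_atTop 1] with n hn
  have hn' : (0 : ℝ) < n := Nat.cast_pos.2 hn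
  rw [le_div_iff₀ hn']
  have h1 : Real.log (P.real (siteToBoundary d n)) ≤ -c * n :=
    (Real.log_le_iff_le_exp (hβpos n)).2 (hcn n)
  linarith

/-- **Grimmett 2006, Thm. (5.55), `ψ` clause, along EVERY direction** (`d ≥ 2`, `0 < p < p_c(ℤ^d)`, `q ≥ 1`, free
or wired, `u ≠ 0`): the rate of `ConnectivityDecayRate.lean` along `u` is strictly positive (`≥ c(p)`: the point
`nu` lies outside `Λ_{n-1}`, so `φ^b(0 ↔ nu) ≤ φ^b(0 ↔ ∂Λ_{n-1}) ≤ e^{-c(n-1)}`). [cite: Grimmett2006, Thm. (5.55)] -/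
theorem IsBoxLimit.exists_decayRate_pos_of_lt_criticalProb (hd : 2 ≤ d) (hP : IsBoxLimit d b p q P)
    (hp : p ∈ Set.Ioc (0 : ℝ) 1) (hq : 1 ≤ q) (hpc : p < criticalProb (zdGraph d) 0) {u : Site d} (hu : u ≠ 0) :
    ∃ ψ : ℝ, 0 < ψ ∧ ψ ≤ -Real.log (P.real (openConn (0 : Site d) u)) ∧
      Tendsto (fun n : ℕ => -Real.log (P.real (openConn (0 : Site d) (n • u))) / n) atTop (𝓝 ψ) ∧
      ∀ n : ℕ, P.real (openConn (0 : Site d) (n • u)) ≤ Real.exp (-(n * ψ)) := by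
  haveI := hP.isProbabilityMeasure
  have hp' : p ∈ Set.Icc (0 : ℝ) 1 := ⟨hp.1.le, hp.2⟩
  obtain ⟨ψ, -, hψ1, hlim, hbd⟩ := hP.exists_decayRate hp hq u
  obtain ⟨c, hc, hcn⟩ := hP.exists_real_openConn_le_exp_of_lt_criticalProb hd hp' hq hpc
  refine ⟨ψ, ?_, hψ1, hlim, hbd⟩
  -- `n • u ∉ Λ_{n-1}` for `n ≥ 1`
  obtain ⟨i, hi⟩ : ∃ i, u i ≠ 0 := by
    by_contra h
    push Not at h
    exact hu (funext h)
  have hout : ∀ n : ℕ, 1 ≤ n → n • u ∉ box d (n - 1) := by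
    intro n hn hmem
    rw [mem_box] at hmem
    have h := hmem i
    simp only [Pi.smul_apply, nsmul_eq_mul] at h
    push_cast [Nat.cast_sub hn] at h
    have hui : 1 ≤ |u i| := Int.one_le_abs hi
    have hn1 : (1 : ℤ) ≤ n := by exact_mod_cast hn
    rcases le_or_gt 0 (u i) with h0 | h0
    · rw [abs_of_nonneg h0] at hui
      nlinarith [h.2]
    · rw [abs_of_neg h0] at hui
      nlinarith [h.1]
  -- `c (n-1)/n → c` is eventually below `-n⁻¹ log φ(0 ↔ nu)`
  have hcl : Tendsto (fun n : ℕ => c * (((n : ℝ) - 1) / n)) atTop (𝓝 c) := by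
    have h1 : Tendsto (fun n : ℕ => ((n : ℝ) - 1) / n) atTop (𝓝 1) := by
      have h := (tendsto_const_nhds (x := (1 : ℝ))).sub tendsto_one_div_atTop_nhds_zero_nat
      rw [sub_zero] at h
      refine h.congr' ?_
      filter_upwards [eventually_ge_atTop 1] with n hn
      have hn' : (n : ℝ) ≠ 0 := (Nat.cast_pos.2 hn).ne'
      field_simp
    have h := h1.const_mul c
    rwa [mul_one] at h
  refine hc.trans_le (le_of_tendsto_of_tendsto hcl hlim ?_)
  filter_upwards [eventually_ge_atTop 1] with n hn
  have hn' : (0 : ℝ) < n := Nat.cast_pos.2 hn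
  have hτpos : 0 < P.real (openConn (0 : Site d) (n • u)) := hP.real_openConn_pos hp hq 0 _
  have h1 : Real.log (P.real (openConn (0 : Site d) (n • u))) ≤ -c * ((n - 1 : ℕ) : ℝ) :=
    (Real.log_le_iff_le_exp hτpos).2 (hcn (n - 1) (n • u) (hout n hn))
  rw [Nat.cast_sub hn, Nat.cast_one] at h1
  rw [mul_div_assoc', le_div_iff₀ hn', div_mul_cancel₀ _ hn'.ne']
  linarith

/-- **Thm. (5.55), `ψ` clause, for `rcLimit d b p q`, radius form** (`d ≥ 2`, `0 < p < p_c(ℤ^d)`, `q ≥ 1`, both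
`b`). [cite: Grimmett2006, Thm. (5.55)] -/
theorem exists_radiusDecayRate_pos_rcLimit_of_lt_criticalProb (hd : 2 ≤ d) (b : Bool) (hp : p ∈ Set.Ioc (0 : ℝ) 1)
    (hq : 1 ≤ q) (hpc : p < criticalProb (zdGraph d) 0) (k : Fin d) :
    ∃ ψ : ℝ, 0 < ψ ∧
      Tendsto (fun n : ℕ =>
        -Real.log ((rcLimit d b p q).real (openConn (0 : Site d) (n • (Pi.single k (1 : ℤ) : Site d)))) / n)
        atTop (𝓝 ψ) ∧
      Tendsto (fun n : ℕ => -Real.log ((rcLimit d b p q).real (siteToBoundary d n)) / n) atTop (𝓝 ψ) ∧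
      (∀ n : ℕ, (rcLimit d b p q).real (openConn (0 : Site d) (n • (Pi.single k (1 : ℤ) : Site d))) ≤
        Real.exp (-(n * ψ))) ∧
      ∀ n : ℕ, (rcLimit d b p q).real (siteToBoundary d n) ≤ 2 * d * (2 * n + 1) ^ (d - 1) * Real.exp (-(n * ψ)) :=
  (isBoxLimit_rcLimit b ⟨hp.1.le, hp.2⟩ hq).exists_radiusDecayRate_pos_of_lt_criticalProb hd hp hq hpc k

/-- **Thm. (5.55), `ψ` clause, for `rcLimit d b p q`, along every direction `u ≠ 0`** (`d ≥ 2`,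
`0 < p < p_c(ℤ^d)`, `q ≥ 1`, both `b`). [cite: Grimmett2006, Thm. (5.55)] -/
theorem exists_decayRate_pos_rcLimit_of_lt_criticalProb (hd : 2 ≤ d) (b : Bool) (hp : p ∈ Set.Ioc (0 : ℝ) 1)
    (hq : 1 ≤ q) (hpc : p < criticalProb (zdGraph d) 0) {u : Site d} (hu : u ≠ 0) :
    ∃ ψ : ℝ, 0 < ψ ∧ ψ ≤ -Real.log ((rcLimit d b p q).real (openConn (0 : Site d) u)) ∧
      Tendsto (fun n : ℕ => -Real.log ((rcLimit d b p q).real (openConn (0 : Site d) (n • u))) / n) atTop (𝓝 ψ) ∧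
      ∀ n : ℕ, (rcLimit d b p q).real (openConn (0 : Site d) (n • u)) ≤ Real.exp (-(n * ψ)) :=
  (isBoxLimit_rcLimit b ⟨hp.1.le, hp.2⟩ hq).exists_decayRate_pos_of_lt_criticalProb hd hp hq hpc hu

end Summit.CriticalPhenomena.PercolationContinuityZ3.Theorems.FK

end
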